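import Literature.MathematicalPhysics.QuantumFieldTheory.Balaban1983to89.B6SectAOperatorsV1

/-!
# NODE 00 — REFINEMENT of nested domain families: if `Ω′_j^{(j)} ⊆ Ω_j^{(j)}` at every level then the finer family's constraints imply the coarser's —
# `N(Q′_{D′}) ⊆ N(Q′_D)` (Lemma S) and `ker Q_{D′} ⊆ ker Q_D` (Lemma V) — [B11] (150)'s «more restrictive functional conditions», theorems only

Cell `pub-ymgap` (HUMAN RULINGS D-0062 ∕ D-0088), seat `pub-ymgap-dag-n07-e` g20 (R141 (C) row s3 lineage; DAG node N07 = [B11]; lane owner, declarer of `Node00.cubeDomains`),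
2026-08-28.  `--kind proof --supports stmt-QuantumFields-20541` (K0⁷; count-neutral).  File A of INTENT-44 (theorems, kernel lane); file B `Node00/DomainsMeet` (the levelwise meet
`D₁ ⊓ D₂`, one definition) imports it.  Answers k0-s1-w3 g5's «Q-CUBE-TOP» (cell bus 2026-08-28 07:03Z) and dag-n07-w4 g3's LOCATED-BOUNDARY-DATUM (07:07Z).

THE PRINT.  [B11] = T. Bałaban, *The variational problem and background fields in renormalization group method for lattice gauge theories*, Commun. Math. Phys. **102** (1985)
277–309 `[Balaban1985Variational]`, p. 301 (150): *«U′_k ∈ 𝔄_k({Ω′_j}, ε₀) ∩ 𝔅_k(ℭ_k, V″) ∩ Ax_k(ℭ_k, 1), where Ω′_j = □_j, j = 0, …, k−1, Ω′_k = □″_k … it is a minimum of this functional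
in the space (150), because this space is defined by MORE RESTRICTIVE FUNCTIONAL CONDITIONS»* ((147)–(148): `Λ′_{k−1} ⊇ □′_k = □_k ∖ Ω_k`, `Λ′_k = □″_k = □_k ∩ Ω_k`).  [B6] = *Propagators
and renormalization transformations for lattice gauge theories. II*, CMP **96** (1984) `[Balaban1984PropagatorsII]`, (2.1)–(2.3) p. 224, (2.6)–(2.7), (2.10), (2.20).

WHY.  `Node00.cubeDomains P a M ρ i` (module 39) puts level `i` on the WHOLE collared top cube; print's (150) keeps the record's FINER level on `□_k ∖ Ω_k`.  At a boundary datum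
(served by the S6 head: n07-w4 LOCATED-BOUNDARY-DATUM) a tangent vector of the `cubeDomains`-fibre supported in `□_k ∖ Ω_k` moves the record's level-(k−1) averages, so the
record's criticality does not transfer to the per-cube problem (k0-s1-w3's witness).  The remedy is a family that is levelwise SMALLER than the record's («more restrictive»):
THIS FILE proves, for ANY two V1 families with `Ω′_j ⊆ Ω_j` for all `j`, that every `D`-indexed block∕bond has end-points not inside `Ω_{j+1} ⊇ Ω′_{j+1}`, hence lit-balaban's
Lemma S ∕ Lemma V for `D′` give `N(Q′_{D′}) ⊆ N(Q′_D)` and `ker Q_{D′} ⊆ ker Q_D` — the inclusion the S4 criticality transfer (`h128` ∕ `critical128`) asks of the per-cube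
family.  File B constructs the family (`Ω′_j := □_j ∩ Ω_j` = the meet `cubeDomains ⊓ D_rec ≤ D_rec`).

WHAT IS PROVED (sorry-free; NO definition; axioms standard; generic `P : Params`, every pair `D′, D` of V1 families with `h : ∀ j, D′.Om j ⊆ D.Om j`).
* §1 `le_k_of_domainsLe` (`Ω′_j ≠ ∅ → j ≤ k(D)`), ★ `not_deep_of_domainsLe` (`¬D.Deep j y → ¬D′.Deep j y`), `not_deep_of_lamSite_of_domainsLe`, `not_deep_of_lamBond_of_domainsLe`.
* §2 ★★ `inGauge_of_domainsLe` (`D′.InGauge λ → D.InGauge λ`), ★★★ `constrZero_of_domainsLe` (`(∀ j b, D′.LamBond j b → Q_jA b = 0) → (∀ j b, D.LamBond j b → Q_jA b = 0)`),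
  ★ `ker_QpE_le_of_domainsLe` (`ker (QpE D′) ≤ ker (QpE D)`), ★ `QE_eq_zero_of_domainsLe` (`QE D′ x = 0 → QE D x = 0`), `ker_QE_le_of_domainsLe`.
HONEST SCOPE.  Set bookkeeping over lit-balaban's V1 files BY NAME (Lemma S `siteAvgIter_eq_zero_of_inGauge`, Lemma V `bondAvgIter_eq_zero_of_constr_zero`, `mem_ker_QpE_iff`,
`QE_eq_zero_iff`); the letters are V1's STRAIGHT averages `Q_j = bondAvgIter j`, `Q′_j = siteAvgIter j` (the record's linearised (0.4) average `Q_j(1)` differs by the comb pure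
gauge, k0-s1-w1's `…K0Stub1FlatAveragingDictionary`; the same argument on `dIterL` is not typed here); nothing about (2.1)–(2.2) admissibility, cube datums, or the record's
`s.Ω`; nothing of [B11]'s analysis asserted; `stub_prop8StepCoP13` ∕ K0⁷ NOT closed; N07 NOT discharged; counts unmoved (28∕28 · 5∕27); one finite 𝕋⁴ programme at fixed ε —
the route closes the conditional finite-𝕋⁴ rung `BalabanLadder.UV` only; nothing continuum ∕ ℝ⁴ ∕ OS ∕ mass gap ∕ Clay.  No `sorry`, no `def`, no `instance`, no `notation`.

References: [B11] (144)–(150) pp. 300–301; [B6] (2.1)–(2.3), (2.6)–(2.7) p. 224, (2.10) p. 225, (2.20) p. 226.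
-/

set_option autoImplicit false

namespace Literature.MathematicalPhysics.QuantumFieldTheory.Balaban1983to89.Node00

open LatticeFieldCalculus (siteAvgIter bondAvgIter)
open B6SectADomainsV1 (Domains)
open B6SectAOperatorsV1 (QE QpE ScalarSpace mem_ker_QpE_iff QE_eq_zero_iff)
open BalabanImbrieJaffe1984to88.BIJ85AxialPropagator411 (BondSpace)

variable {P : Params}

/-! ## §1  Refinement `Ω′_j ⊆ Ω_j` (levelwise): deepness and indexing -/

/-- A non-empty region of the finer family lies at a level of the coarser one: `Ω′_j ≠ ∅ → j ≤ k(D)`. [cite: Balaban1984PropagatorsII, (2.1) p.224 (bookkeeping)] -/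
theorem le_k_of_domainsLe {D' D : Domains P} (h : ∀ j : ℕ, D'.Om j ⊆ D.Om j) {j : ℕ} (hj : (D'.Om j).Nonempty) : j ≤ D.k := by
  by_contra hlt
  have hempty : D.Om j = ∅ := D.Om_eq_empty (not_le.mp hlt)
  obtain ⟨y, hy⟩ := hj
  have := h j hy
  rw [hempty] at this
  exact absurd this (Finset.notMem_empty y)

/-- ★ **Deepness is monotone**: a `j`-block inside `Ω′_{j+1}` is inside `Ω_{j+1}`; contrapositively, a block NOT inside `Ω_{j+1}` is not inside `Ω′_{j+1}` — so every `D`-indexed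
block or bond (whose end-points are not deep for `D`, (2.3)) has end-points not deep for `D′`. [cite: Balaban1984PropagatorsII, (2.3) p.224] -/
theorem not_deep_of_domainsLe {D' D : Domains P} (h : ∀ j : ℕ, D'.Om j ⊆ D.Om j) {j : ℕ} {y : Site P j} (hy : ¬ D.Deep j y) : ¬ D'.Deep j y :=
  fun hy' => hy (h (j + 1) hy')

/-- A `D`-indexed site is not `D′`-deep. [cite: Balaban1984PropagatorsII, (2.3) p.224] -/
theorem not_deep_of_lamSite_of_domainsLe {D' D : Domains P} (h : ∀ j : ℕ, D'.Om j ⊆ D.Om j) {j : ℕ} {y : Site P j} (hy : D.LamSite j y) : ¬ D'.Deep j y :=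
  not_deep_of_domainsLe h hy.2

/-- The end-points of a `D`-indexed bond are not `D′`-deep. [cite: Balaban1984PropagatorsII, (2.3) p.224] -/
theorem not_deep_of_lamBond_of_domainsLe {D' D : Domains P} (h : ∀ j : ℕ, D'.Om j ⊆ D.Om j) {j : ℕ} {b : PBond P j} (hb : D.LamBond j b) :
    ¬ D'.Deep j b.src ∧ ¬ D'.Deep j b.tgt :=
  ⟨not_deep_of_domainsLe h hb.2.1, not_deep_of_domainsLe h hb.2.2⟩

/-! ## §2  Finer families have smaller kernels: `N(Q′_{D′}) ⊆ N(Q′_D)` (Lemma S) and `ker Q_{D′} ⊆ ker Q_D` (Lemma V) -/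

/-- ★★ **Gauge classes refine**: if `λ` satisfies the (2.7) conditions of the FINER family (`λ = 0` on `Λ′₀`, `Q′_jλ = 0` on `Λ′_j`) then it satisfies those of the coarser one —
Lemma S for `D′` (`siteAvgIter_eq_zero_of_inGauge`: `Q′_jλ` vanishes on every `j`-block not inside `Ω′_{j+1}`) at the `D`-indexed blocks, which are not inside `Ω_{j+1} ⊇ Ω′_{j+1}`.
[cite: Balaban1984PropagatorsII, (2.7) p.224, (2.10) p.225] -/
theorem inGauge_of_domainsLe {D' D : Domains P} (h : ∀ j : ℕ, D'.Om j ⊆ D.Om j) {lam : SiteField P 0 ℝ} (hlam : D'.InGauge lam) : D.InGauge lam :=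
  fun j y hy => D'.siteAvgIter_eq_zero_of_inGauge hlam j y (not_deep_of_lamSite_of_domainsLe h hy)

/-- ★★★ **Constraints refine** ((150) «more restrictive functional conditions», linear∕homogeneous form): if the STRAIGHT averages of `A` vanish on every `D′`-indexed bond then they
vanish on every `D`-indexed bond — Lemma V for `D′` (`bondAvgIter_eq_zero_of_constr_zero`: `Q_jA` vanishes on every `j`-bond whose end-points are not inside `Ω′_{j+1}`) at the
`D`-indexed bonds.  Hence `ker Q_{D′} ⊆ ker Q_D`: a tangent vector of the finer fibre is tangent to the coarser one. [cite: Balaban1984PropagatorsII, (2.6) p.224, (2.20) p.226; Balaban1985Variational, (150) p.301] -/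
theorem constrZero_of_domainsLe {D' D : Domains P} (h : ∀ j : ℕ, D'.Om j ⊆ D.Om j) {A : VecField P 0 ℝ}
    (hA : ∀ (j : ℕ) (b : PBond P j), D'.LamBond j b → bondAvgIter j A b = 0) :
    ∀ (j : ℕ) (b : PBond P j), D.LamBond j b → bondAvgIter j A b = 0 :=
  fun j b hb => D'.bondAvgIter_eq_zero_of_constr_zero hA j b (not_deep_of_lamBond_of_domainsLe h hb).1 (not_deep_of_lamBond_of_domainsLe h hb).2

/-- ★ Operator form on `L²(T_η)`: `N(Q′_{D′}) ≤ N(Q′_D)` as kernels of lit-balaban's multi-scale `Q′` ([B6] (2.14)). [cite: Balaban1984PropagatorsII, (2.10) p.225, (2.14) p.225] -/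
theorem ker_QpE_le_of_domainsLe {D' D : Domains P} (h : ∀ j : ℕ, D'.Om j ⊆ D.Om j) : LinearMap.ker (QpE D') ≤ LinearMap.ker (QpE D) := by
  intro f hf
  rw [mem_ker_QpE_iff] at hf ⊢
  exact inGauge_of_domainsLe h hf

/-- ★ Operator form on vector fields: `Q_{D′}x = 0 ⇒ Q_Dx = 0` for lit-balaban's multi-scale `Q` ([B6] (2.20)). [cite: Balaban1984PropagatorsII, (2.20) p.226] -/
theorem QE_eq_zero_of_domainsLe {D' D : Domains P} (h : ∀ j : ℕ, D'.Om j ⊆ D.Om j) {x : BondSpace P} (hx : QE D' x = 0) : QE D x = 0 := by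
  rw [QE_eq_zero_iff] at hx ⊢
  exact constrZero_of_domainsLe h hx

/-- `ker Q_{D′} ≤ ker Q_D` as submodules. [cite: Balaban1984PropagatorsII, (2.20) p.226] -/
theorem ker_QE_le_of_domainsLe {D' D : Domains P} (h : ∀ j : ℕ, D'.Om j ⊆ D.Om j) : LinearMap.ker (QE D') ≤ LinearMap.ker (QE D) :=
  fun _ hx => LinearMap.mem_ker.mpr (QE_eq_zero_of_domainsLe h (LinearMap.mem_ker.mp hx))


end Literature.MathematicalPhysics.QuantumFieldTheory.Balaban1983to89.Node00
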